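import Summits.QuantumFields.BalabanUV.Gaps.EndDrawdownLinearRoad

/-!
# Gaps / EndDrawdownCooperatorExtremal — THE MONOTONE COOPERATOR IS EXTREMAL: over every realization class of a one-loop sequence `b` whose
# remainder is bounded ABOVE by a continuous non-decreasing help `H(g_k)` of the last coupling (`β¹_{k+1}(g_0,…,g_k) ≤ H(g_k)` on the box
# histories — the linear (AF-1) class `H = C·x`, every modulus class `H = C·ω`, the profile cooperators `H = Φ_t`), the END statement is POSSIBLE
# iff ONE Markov family has it, the COOPERATOR `β_{k+1} = b_k + H(g_k)`, and for the cooperator `EndpointExistence` is decided by ONE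
# deterministic object per `(K, target)`: the BACKWARD ORBIT of the clamped step map `F_i(y) = y − b_i − H(ĝ_γ(y))` (`ĝ_γ` the tree's clamp,
# `y = 1∕g²`), which is strictly increasing (slope ≥ 1) and onto — so the orbit exists, is unique, is monotone in the target, and DOMINATES
# (`1∕g_i² ≤ z_i`) every in-box run of every forward-generated construction of every realization in the class ending at the same coupling.
# Consequences (all for EVERY forward-generated construction of the cooperator): E transfers from ANY dominated realization (no continuity and
# no LOWER bound on its remainder needed); ONE reachable target per small box suffices for E; E for one forward-generated construction of the
# cooperator is E for all.  The linear-road corollaries (`EndDrawdownLinearRoad.EndPossibleLin` ⟺ E of `modelOf (betaLin b C)`, one-sided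
# class = two-sided class, box-free) and the RECOVERING STAIRCASE (possibility on the linear road does NOT read the drawdown profile) are the
# sequel `EndDrawdownLinearRecovering` (cell pub-balaban-gaps, seat g1-p3 GEN 10, rows CAP ∕ tail ∕ (D4) «split ∕ weakening»; this seat's own
# leaf; file 17 of «the one-loop interface of the END statement»)

HONEST FRAMING (cell rule, page 1 of everything): [folklore] real analysis (a strictly increasing continuous self-map of ℝ is onto; backward
induction along its inverse orbit) on the tree's clamped-run carrier `FlowStep.gClamp` and forward uniqueness `FlowStepRuns.flow_eq_of_rgEqH`;
`EndpointExistence` is the cell's END-grade statement SHAPE read over Bałaban-free data; NOTHING of Bałaban's table is certified (NODE-O 0∕1,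
CAP coefficients 0); words ∕ odds of rows CAP ∕ tail ∕ (D4) ∕ (D1) UNCHANGED; 0∕6 binders; one finite T⁴; NOT [I] Thm 2, NOT `BetaPertH`,
NOT the continuum limit, NOT Clay.

CITATION HEADER (tags CONTEXT ONLY).  [I] = T. Bałaban, Commun. Math. Phys. **109** (1987) 249–301 [Balaban1987RG1]: (0.20) p. 256, Thm 2
p. 259 (first sentence), (1.22) p. 264, (2.12)–(2.14) p. 268.
-/

namespace Summit.QuantumFields.BalabanUV.Gaps.EndDrawdownCooperatorExtremal

open Literature.MathematicalPhysics.QuantumFieldTheory.Balaban1983to89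
open Literature.MathematicalPhysics.QuantumFieldTheory.Balaban1983to89.FlowStep
open Literature.MathematicalPhysics.QuantumFieldTheory.Balaban1983to89.FlowStepRuns
open Literature.MathematicalPhysics.QuantumFieldTheory.Balaban1983to89.DagBinding
open Summit.QuantumFields.BalabanUV.Gaps.CapSignsNecessaryFwd (step_ge_of_forwardGenerated)
open Summit.QuantumFields.BalabanUV.Gaps.EndRunwiseShooting (gClamp_inv_sq)
open Summit.QuantumFields.BalabanUV.Gaps.EndDrawdownLinearRoad
open Filter
open scoped Topology

noncomputable section

variable {b : ℕ → ℝ} {H : ℝ → ℝ} {γ : ℝ}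

/-! ## §1 The clamped step map of a monotone cooperator: slope ≥ 1, continuous, onto -/

/-- THE CLAMPED STEP MAP of step `i` for the cooperator `β_{k+1} = b_k + H(g_k)` on the box `]0,γ]`: `F_i(y) := y − b_i − H(ĝ_γ(y))`, `ĝ_γ` the
tree's clamp `FlowStep.gClamp` (so `y_{i+1} = F_i(y_i)` along the clamped forward run of `1∕g²`). [folklore] -/
def stepMap (b : ℕ → ℝ) (H : ℝ → ℝ) (γ : ℝ) (i : ℕ) (y : ℝ) : ℝ := y - b i - H (gClamp γ y)

/-- Unfolding. [folklore] -/
theorem stepMap_apply (i : ℕ) (y : ℝ) : stepMap b H γ i y = y - b i - H (gClamp γ y) := rfl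

/-- The help along the clamp is ANTITONE in `y = 1∕g²` when `H` is non-decreasing in the coupling on `]0,γ]`. [folklore] -/
theorem help_antitone (hγ : 0 < γ) (hHm : MonotoneOn H (Set.Ioc 0 γ)) : Antitone fun y => H (gClamp γ y) :=
  fun _ _ h => hHm ⟨gClamp_pos hγ _, gClamp_le hγ _⟩ ⟨gClamp_pos hγ _, gClamp_le hγ _⟩ (gClamp_antitone hγ h)

/-- SLOPE ≥ 1: `v − u ≤ F_i(v) − F_i(u)` for `u ≤ v`. [folklore] -/
theorem sub_le_stepMap_sub (hγ : 0 < γ) (hHm : MonotoneOn H (Set.Ioc 0 γ)) (i : ℕ) {u v : ℝ} (h : u ≤ v) :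
    v - u ≤ stepMap b H γ i v - stepMap b H γ i u := by
  have := help_antitone hγ hHm h
  simp only [stepMap_apply]
  linarith

/-- … so `F_i` reflects `≤`: `F_i(u) ≤ F_i(v) ⟹ u ≤ v` (strictly increasing). [folklore] -/
theorem le_of_stepMap_le (hγ : 0 < γ) (hHm : MonotoneOn H (Set.Ioc 0 γ)) (i : ℕ) {u v : ℝ}
    (h : stepMap b H γ i u ≤ stepMap b H γ i v) : u ≤ v := by
  by_contra hlt
  have := sub_le_stepMap_sub (b := b) hγ hHm i (not_le.mp hlt).le
  linarith

/-- `F_i` is continuous when `H` is continuous on `]0,γ]` (the clamp is continuous with values in `]0,γ]`). [folklore] -/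
theorem continuous_stepMap (hγ : 0 < γ) (hHc : ContinuousOn H (Set.Ioc 0 γ)) (i : ℕ) : Continuous (stepMap b H γ i) := by
  have hc : Continuous fun y => H (gClamp γ y) :=
    hHc.comp_continuous (continuous_gClamp hγ) fun y => ⟨gClamp_pos hγ y, gClamp_le hγ y⟩
  show Continuous fun y => y - b i - H (gClamp γ y)
  exact (continuous_id.sub continuous_const).sub hc

/-- `F_i` is ONTO ℝ (continuous, `F_i(y) ≥ y + c` for `y ≥ 0`, `F_i(y) ≤ y + c` for `y ≤ 0`). [folklore] -/
theorem stepMap_surjective (hγ : 0 < γ) (hHc : ContinuousOn H (Set.Ioc 0 γ)) (hHm : MonotoneOn H (Set.Ioc 0 γ)) (i : ℕ) :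
    Function.Surjective (stepMap b H γ i) := by
  have hanti := help_antitone hγ hHm
  refine (continuous_stepMap (b := b) hγ hHc i).surjective ?_ ?_
  · have hle : ∀ᶠ y in atTop, y + (-(b i) - H (gClamp γ 0)) ≤ stepMap b H γ i y :=
      (eventually_ge_atTop (0 : ℝ)).mono fun y hy => by
        have := hanti hy; simp only [stepMap_apply]; linarith
    exact tendsto_atTop_mono' atTop hle (tendsto_atTop_add_const_right _ _ tendsto_id)
  · have hle : ∀ᶠ y in atBot, stepMap b H γ i y ≤ y + (-(b i) - H (gClamp γ 0)) :=
      (eventually_le_atBot (0 : ℝ)).mono fun y hy => by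
        have := hanti hy; simp only [stepMap_apply]; linarith
    exact tendsto_atBot_mono' atBot hle (tendsto_atBot_add_const_right _ _ tendsto_id)

/-! ## §2 Backward orbits: existence, monotonicity in the target, domination of every dominated trajectory -/

/-- **BACKWARD ORBITS EXIST** · for every horizon `K` and every terminal value `Yt` there is `z` with `z_K = Yt` and `F_i(z_i) = z_{i+1}` for
`i < K` (each `F_i` is onto).  By `le_of_stepMap_le` the orbit is unique on `[0, K]`. [folklore] -/
theorem exists_backOrbit (hγ : 0 < γ) (hHc : ContinuousOn H (Set.Ioc 0 γ)) (hHm : MonotoneOn H (Set.Ioc 0 γ)) (K : ℕ) (Yt : ℝ) :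
    ∃ z : ℕ → ℝ, z K = Yt ∧ ∀ i, i < K → stepMap b H γ i (z i) = z (i + 1) := by
  suffices h : ∀ d, d ≤ K → ∃ z : ℕ → ℝ, z K = Yt ∧ ∀ i, K - d ≤ i → i < K → stepMap b H γ i (z i) = z (i + 1) by
    obtain ⟨z, hz, h⟩ := h K le_rfl
    exact ⟨z, hz, fun i hi => h i (by omega) hi⟩
  intro d
  induction d with
  | zero => exact fun _ => ⟨fun _ => Yt, rfl, fun i h1 h2 => absurd h2 (by omega)⟩
  | succ d ih =>
    intro hd
    obtain ⟨z, hzK, hz⟩ := ih (by omega)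
    obtain ⟨y, hy⟩ := stepMap_surjective (b := b) hγ hHc hHm (K - (d + 1)) (z (K - d))
    refine ⟨Function.update z (K - (d + 1)) y, ?_, fun i h1 h2 => ?_⟩
    · rw [Function.update_of_ne (by omega)]; exact hzK
    · rcases Nat.eq_or_lt_of_le h1 with h | h
      · subst h
        rw [Function.update_self, Function.update_of_ne (by omega), show K - (d + 1) + 1 = K - d by omega]
        exact hy
      · rw [Function.update_of_ne (by omega), Function.update_of_ne (by omega)]
        exact hz i (by omega) h2

/-- **MONOTONE IN THE TARGET** · two backward orbits with `z_K ≤ z'_K` satisfy `z_i ≤ z'_i` for all `i ≤ K` — a SMALLER target coupling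
(larger `1∕g²`) only raises the orbit. [folklore] -/
theorem backOrbit_mono (hγ : 0 < γ) (hHm : MonotoneOn H (Set.Ioc 0 γ)) {K : ℕ} {z z' : ℕ → ℝ}
    (hz : ∀ i, i < K → stepMap b H γ i (z i) = z (i + 1)) (hz' : ∀ i, i < K → stepMap b H γ i (z' i) = z' (i + 1))
    (hK : z K ≤ z' K) : ∀ i, i ≤ K → z i ≤ z' i := by
  suffices h : ∀ d i, i + d = K → z i ≤ z' i from fun i hi => h (K - i) i (by omega)
  intro d
  induction d with
  | zero => intro i hi; rw [show i = K by omega]; exact hK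
  | succ d ih =>
    intro i hi
    have h := ih (i + 1) (by omega)
    rw [← hz i (by omega), ← hz' i (by omega)] at h
    exact le_of_stepMap_le (b := b) hγ hHm i h

/-- Along a backward orbit of a cooperator with NON-NEGATIVE help on `]0,γ]`, one step back GAINS at least the one-loop coefficient:
`z_{i+1} + b_i ≤ z_i` (`i < K`). [folklore] -/
theorem backOrbit_succ_add_le (hγ : 0 < γ) (hH0 : ∀ x, 0 < x → x ≤ γ → 0 ≤ H x) {K : ℕ} {z : ℕ → ℝ}
    (hz : ∀ i, i < K → stepMap b H γ i (z i) = z (i + 1)) {i : ℕ} (hi : i < K) : z (i + 1) + b i ≤ z i := by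
  have h := hz i hi
  rw [stepMap_apply] at h
  have := hH0 _ (gClamp_pos hγ (z i)) (gClamp_le hγ (z i))
  linarith

/-- … summed: `z_j + Σ_{[i,j)} b ≤ z_i` for `i ≤ j ≤ K` — along the orbit, read backward, `1∕g²` gains at least the window sums of the one-loop
part (the recoveries of `b` are banked in full, its drawdowns cost at most their size). [folklore] -/
theorem backOrbit_add_sum_le (hγ : 0 < γ) (hH0 : ∀ x, 0 < x → x ≤ γ → 0 ≤ H x) {K : ℕ} {z : ℕ → ℝ}
    (hz : ∀ i, i < K → stepMap b H γ i (z i) = z (i + 1)) {i j : ℕ} (hij : i ≤ j) (hj : j ≤ K) :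
    z j + ∑ l ∈ Finset.Ico i j, b l ≤ z i := by
  induction j, hij using Nat.le_induction with
  | base => simp
  | succ n hin ih =>
    rw [Finset.sum_Ico_succ_top hin]
    have h1 := ih (by omega)
    have h2 := backOrbit_succ_add_le (b := b) hγ hH0 hz (i := n) (by omega)
    linarith

/-- **DOMINATION** · a positive coupling trajectory `g'_0, …, g'_K` in `]0,γ]` whose steps are bounded on ONE side by the cooperator's,
`1∕g'_i² − 1∕g'_{i+1}² ≤ b_i + H(g'_i)` (`i < K`) — e.g. any in-box run of any forward-generated construction of ANY history family
`b_k + β¹_{k+1}` with `β¹_{k+1} ≤ H(g_k)` — lies BELOW every backward orbit with `1∕g'_K² ≤ z_K`: `1∕g'_i² ≤ z_i` for all `i ≤ K`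
(backward induction: `F_i(1∕g'_i²) ≤ 1∕g'_{i+1}² ≤ z_{i+1} = F_i(z_i)` and `F_i` reflects `≤`). [folklore] -/
theorem backOrbit_ge_traj (hγ : 0 < γ) (hHm : MonotoneOn H (Set.Ioc 0 γ)) {K : ℕ} {g' : ℕ → ℝ}
    (hI : ∀ i, i ≤ K → 0 < g' i ∧ g' i ≤ γ) (hstep : ∀ i, i < K → 1 / (g' i) ^ 2 - 1 / (g' (i + 1)) ^ 2 ≤ b i + H (g' i))
    {z : ℕ → ℝ} (hzK : 1 / (g' K) ^ 2 ≤ z K) (hz : ∀ i, i < K → stepMap b H γ i (z i) = z (i + 1)) :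
    ∀ i, i ≤ K → 1 / (g' i) ^ 2 ≤ z i := by
  suffices h : ∀ d i, i + d = K → 1 / (g' i) ^ 2 ≤ z i from fun i hi => h (K - i) i (by omega)
  intro d
  induction d with
  | zero => intro i hi; rw [show i = K by omega]; exact hzK
  | succ d ih =>
    intro i hi
    have hiK : i < K := by omega
    have ih' := ih (i + 1) (by omega)
    have hF : stepMap b H γ i (1 / (g' i) ^ 2) ≤ 1 / (g' (i + 1)) ^ 2 := by
      rw [stepMap_apply, gClamp_inv_sq (hI i hiK.le).1 (hI i hiK.le).2]
      linarith [hstep i hiK]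
    exact le_of_stepMap_le (b := b) hγ hHm i (hF.trans (ih'.trans_eq (hz i hiK).symm))

/-- Along an in-box run of a forward-generated construction of a history family of the form `β_{k+1}(p) = b_k + β¹_{k+1}(p)` with
`β¹_{k+1}(p) ≤ H(p_k)` on the `]0,γ]`-histories, the steps are dominated: `1∕g_i² − 1∕g_{i+1}² ≤ b_i + H(g_i)` (forward generation gives
`≤ β_{i+1}(g_0,…,g_i)`, `CapSignsNecessaryFwd.step_ge_of_forwardGenerated`). [cite: Balaban1987RG1, (0.20) p.256] -/
theorem steps_dominated_of_run {β' : HBeta} (S' : B12Beta.OneLoopSplit β') (hb : ∀ j, S'.β0 j = b j)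
    (hup : ∀ (k : ℕ) (p : Fin (k + 1) → ℝ), p ∈ B12Beta.HistBox γ k → S'.β1 k p ≤ H (p (Fin.last k)))
    {C' : B12.Construction} (hgen' : ForwardGenerated C' β') (P : B12.RunParams) (hI : (C' P).flow.InInterval γ P.K) :
    ∀ i, i < P.K → 1 / ((C' P).flow.g i) ^ 2 - 1 / ((C' P).flow.g (i + 1)) ^ 2 ≤ b i + H ((C' P).flow.g i) := by
  intro i hi
  have hstep := step_ge_of_forwardGenerated hgen' P hI hi
  have hpre : prefixOf (C' P).flow.g i ∈ B12Beta.HistBox γ i := fun j => hI j (by have := j.isLt; omega)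
  have hsplit : β' i (prefixOf (C' P).flow.g i) = b i + S'.β1 i (prefixOf (C' P).flow.g i) := by rw [S'.split, hb]
  have hup' : S'.β1 i (prefixOf (C' P).flow.g i) ≤ H ((C' P).flow.g i) := hup i _ hpre
  linarith

/-- … and along an in-box run of a forward-generated construction of the COOPERATOR itself (`β_{k+1}(p) = b_k + H(p_k)` on positive last
coupling) the steps are dominated too (with equality at solvable steps). [cite: Balaban1987RG1, (0.20) p.256] -/
theorem steps_dominated_of_coopRun {β : HBeta} (hβ : ∀ (k : ℕ) (p : Fin (k + 1) → ℝ), 0 < p (Fin.last k) → β k p = b k + H (p (Fin.last k)))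
    {C : B12.Construction} (hgen : ForwardGenerated C β) (P : B12.RunParams) (hI : (C P).flow.InInterval γ P.K) :
    ∀ i, i < P.K → 1 / ((C P).flow.g i) ^ 2 - 1 / ((C P).flow.g (i + 1)) ^ 2 ≤ b i + H ((C P).flow.g i) := by
  intro i hi
  have hstep := step_ge_of_forwardGenerated hgen P hI hi
  rw [hβ i _ (hI i hi.le).1] at hstep
  exact hstep

/-! ## §3 From a backward orbit above the clamp to a genuine run of EVERY forward-generated construction of the cooperator -/

/-- **ORBIT ⟹ RUN** · if the backward orbit `z` ending at `z_K = 1∕g²` (`0 < g ≤ γ`) stays `≥ 1∕γ²` on `[0, K]`, then EVERY forward-generated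
construction of the cooperator has, at every torus exponent `m`, a run in `]0,γ]` with `g_K = g` and `1∕g_i² = z_i` (couplings `ĝ_γ(z_i)`;
the clamp is inactive, (0.20) holds, forward uniqueness `FlowStepRuns.flow_eq_of_rgEqH`). [cite: Balaban1987RG1, (0.20) p.256 and Thm 2 p.259] -/
theorem run_of_backOrbit {β : HBeta} (hβ : ∀ (k : ℕ) (p : Fin (k + 1) → ℝ), 0 < p (Fin.last k) → β k p = b k + H (p (Fin.last k)))
    (hγ : 0 < γ) {C : B12.Construction} (hgen : ForwardGenerated C β) {g : ℝ} (hg : 0 < g) (hgγ : g ≤ γ) {K : ℕ} (m : ℕ)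
    {z : ℕ → ℝ} (hzK : z K = 1 / g ^ 2) (hz : ∀ i, i < K → stepMap b H γ i (z i) = z (i + 1))
    (hA : ∀ i, i ≤ K → 1 / γ ^ 2 ≤ z i) :
    ∃ g0 : ℝ, (C ⟨K, m, g0⟩).flow.InInterval γ K ∧ (C ⟨K, m, g0⟩).flow.g K = g ∧
      ∀ i, i ≤ K → 1 / ((C ⟨K, m, g0⟩).flow.g i) ^ 2 = z i := by
  set gs : ℕ → ℝ := fun k => gClamp γ (z k) with hgs
  have hrg : RGEqH K β gs := by
    intro k hk
    show 1 / (gClamp γ (z k)) ^ 2 = 1 / (gClamp γ (z (k + 1))) ^ 2 + β k (prefixOf gs k)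
    rw [inv_sq_gClamp hγ (hA k hk.le), inv_sq_gClamp hγ (hA (k + 1) hk), hβ k _ (gClamp_pos hγ _)]
    have e : prefixOf gs k (Fin.last k) = gClamp γ (z k) := by
      show gClamp γ (z ((Fin.last k : Fin (k + 1)) : ℕ)) = _
      rw [Fin.val_last]
    rw [e]
    have h := hz k hk
    rw [stepMap_apply] at h
    linarith
  have hI : ∀ k, k ≤ K → 0 < gs k ∧ gs k ≤ γ := fun k _ => ⟨gClamp_pos hγ _, gClamp_le hγ _⟩
  have heq : ∀ k, k ≤ K → (C ⟨K, m, gs 0⟩).flow.g k = gs k :=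
    flow_eq_of_rgEqH (C ⟨K, m, gs 0⟩).flow β K (fun k hk => hgen.2 ⟨K, m, gs 0⟩ k hk)
      (hgen.1 ⟨K, m, gs 0⟩) hrg (fun k hk => (hI k hk).1)
  refine ⟨gs 0, fun k hk => ?_, ?_, fun i hi => ?_⟩
  · rw [heq k hk]; exact hI k hk
  · rw [heq K le_rfl]
    show gClamp γ (z K) = g
    rw [hzK, gClamp_inv_sq hg hgγ]
  · rw [heq i hi]
    exact inv_sq_gClamp hγ (hA i hi)

/-- **THE COOPERATOR INHERITS EVERY DOMINATED RUN** · `H` continuous and non-decreasing on `]0,γ]`; a positive trajectory `g'` in `]0,γ]` up to `K`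
with dominated steps (`backOrbit_ge_traj`); then EVERY forward-generated construction of the cooperator `β_{k+1} = b_k + H(g_k)` has a run in
`]0,γ]` ending at ANY target `g ∈ ]0, g'_K]`, with couplings `g_i ≤ g'_i` when `g = g'_K`… here: `1∕g'_i² ≤ 1∕g_i²` for `i ≤ K`.
[cite: Balaban1987RG1, (0.20) p.256 and Thm 2 p.259 (first sentence)] -/
theorem run_coop_of_traj (hγ : 0 < γ) (hHc : ContinuousOn H (Set.Ioc 0 γ)) (hHm : MonotoneOn H (Set.Ioc 0 γ))
    {K : ℕ} {g' : ℕ → ℝ} (hI : ∀ i, i ≤ K → 0 < g' i ∧ g' i ≤ γ)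
    (hstep : ∀ i, i < K → 1 / (g' i) ^ 2 - 1 / (g' (i + 1)) ^ 2 ≤ b i + H (g' i))
    {β : HBeta} (hβ : ∀ (k : ℕ) (p : Fin (k + 1) → ℝ), 0 < p (Fin.last k) → β k p = b k + H (p (Fin.last k)))
    {C : B12.Construction} (hgen : ForwardGenerated C β) {g : ℝ} (hg : 0 < g) (hgle : g ≤ g' K) (m : ℕ) :
    ∃ g0 : ℝ, (C ⟨K, m, g0⟩).flow.InInterval γ K ∧ (C ⟨K, m, g0⟩).flow.g K = g ∧
      ∀ i, i ≤ K → 1 / (g' i) ^ 2 ≤ 1 / ((C ⟨K, m, g0⟩).flow.g i) ^ 2 := by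
  obtain ⟨z, hzK, hz⟩ := exists_backOrbit (b := b) hγ hHc hHm K (1 / g ^ 2)
  have hzK' : 1 / (g' K) ^ 2 ≤ z K := by
    rw [hzK]; exact one_div_le_one_div_of_le (pow_pos hg 2) (pow_le_pow_left₀ hg.le hgle 2)
  have hdom := backOrbit_ge_traj hγ hHm hI hstep hzK' hz
  have hA : ∀ i, i ≤ K → 1 / γ ^ 2 ≤ z i := fun i hi =>
    (one_div_le_one_div_of_le (pow_pos (hI i hi).1 2) (pow_le_pow_left₀ (hI i hi).1.le (hI i hi).2 2)).trans (hdom i hi)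
  obtain ⟨g0, hI0, hK0, hy⟩ := run_of_backOrbit hβ hγ hgen hg (hgle.trans (hI K le_rfl).2) m hzK hz hA
  exact ⟨g0, hI0, hK0, fun i hi => by rw [hy i hi]; exact hdom i hi⟩

/-! ## §4 Consequences at END grade -/

/-- **E TRANSFERS TO THE COOPERATOR FROM ANY DOMINATED REALIZATION** · `H` continuous and non-decreasing on `]0,γ₀]`; a history family `β′`
with one-loop part `b` and remainder bounded ABOVE by the help, `β¹′_{k+1}(p) ≤ H(p_k)` on the `]0,γ₀]`-histories (NO lower bound, NO
continuity asked of `β′`); if SOME forward-generated construction of `β′` has `EndpointExistence`, then EVERY forward-generated construction of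
the cooperator `β_{k+1} = b_k + H(g_k)` has it (same `g⋆`, `γ₂ ∧ γ₀`). [cite: Balaban1987RG1, Thm 2 p.259 (first sentence) and (0.20) p.256] -/
theorem endpointExistence_coop_of_dominated {γ₀ : ℝ} (hγ₀ : 0 < γ₀) (hHc : ContinuousOn H (Set.Ioc 0 γ₀))
    (hHm : MonotoneOn H (Set.Ioc 0 γ₀)) {β' : HBeta} (S' : B12Beta.OneLoopSplit β') (hb : ∀ j, S'.β0 j = b j)
    (hup : ∀ (k : ℕ) (p : Fin (k + 1) → ℝ), p ∈ B12Beta.HistBox γ₀ k → S'.β1 k p ≤ H (p (Fin.last k)))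
    {C' : B12.Construction} (hgen' : ForwardGenerated C' β') (hE' : EndpointExistence C')
    {β : HBeta} (hβ : ∀ (k : ℕ) (p : Fin (k + 1) → ℝ), 0 < p (Fin.last k) → β k p = b k + H (p (Fin.last k)))
    {C : B12.Construction} (hgen : ForwardGenerated C β) : EndpointExistence C := by
  intro m
  obtain ⟨γ₂, hγ₂, h⟩ := hE' m
  refine ⟨min γ₂ γ₀, lt_min hγ₂ hγ₀, fun γ hγ hγle => ?_⟩
  obtain ⟨gstar, hgstar, hg⟩ := h γ hγ (hγle.trans (min_le_left _ _))
  refine ⟨gstar, hgstar, fun g hg0 hgle K => ?_⟩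
  obtain ⟨g0', hI', hK'⟩ := hg g hg0 hgle K
  have hγγ₀ : γ ≤ γ₀ := hγle.trans (min_le_right _ _)
  have hsub : Set.Ioc 0 γ ⊆ Set.Ioc 0 γ₀ := fun x hx => ⟨hx.1, hx.2.trans hγγ₀⟩
  have hsteps := steps_dominated_of_run (γ := γ) S' hb
    (fun k p hp => hup k p fun i => ⟨(hp i).1, (hp i).2.trans hγγ₀⟩) hgen' ⟨K, m, g0'⟩ hI'
  obtain ⟨g0, hI0, hK0, -⟩ := run_coop_of_traj hγ (hHc.mono hsub) (hHm.mono hsub) hI' hsteps hβ hgen hg0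
    (le_of_eq hK'.symm) m
  exact ⟨g0, hI0, hK0⟩

/-- **E FOR ONE CONSTRUCTION OF THE COOPERATOR IS E FOR ALL** (`H` continuous non-decreasing on `]0,γ₀]`; `γ₂` shrunk to `γ₂ ∧ γ₀`).
[cite: Balaban1987RG1, Thm 2 p.259 (first sentence) and (0.20) p.256] -/
theorem endpointExistence_coop_of_coop {γ₀ : ℝ} (hγ₀ : 0 < γ₀) (hHc : ContinuousOn H (Set.Ioc 0 γ₀))
    (hHm : MonotoneOn H (Set.Ioc 0 γ₀))
    {β : HBeta} (hβ : ∀ (k : ℕ) (p : Fin (k + 1) → ℝ), 0 < p (Fin.last k) → β k p = b k + H (p (Fin.last k)))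
    {C₁ : B12.Construction} (hgen₁ : ForwardGenerated C₁ β) (hE₁ : EndpointExistence C₁)
    {C : B12.Construction} (hgen : ForwardGenerated C β) : EndpointExistence C := by
  intro m
  obtain ⟨γ₂, hγ₂, h⟩ := hE₁ m
  refine ⟨min γ₂ γ₀, lt_min hγ₂ hγ₀, fun γ hγ hγle => ?_⟩
  obtain ⟨gstar, hgstar, hg⟩ := h γ hγ (hγle.trans (min_le_left _ _))
  refine ⟨gstar, hgstar, fun g hg0 hgle K => ?_⟩
  obtain ⟨g0', hI', hK'⟩ := hg g hg0 hgle K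
  have hγγ₀ : γ ≤ γ₀ := hγle.trans (min_le_right _ _)
  have hsub : Set.Ioc 0 γ ⊆ Set.Ioc 0 γ₀ := fun x hx => ⟨hx.1, hx.2.trans hγγ₀⟩
  obtain ⟨g0, hI0, hK0, -⟩ := run_coop_of_traj hγ (hHc.mono hsub) (hHm.mono hsub) hI'
    (steps_dominated_of_coopRun hβ hgen₁ ⟨K, m, g0'⟩ hI') hβ hgen hg0 (le_of_eq hK'.symm) m
  exact ⟨g0, hI0, hK0⟩

/-- **ONE TARGET PER BOX SUFFICES** · for the cooperator (`H` continuous non-decreasing on `]0,γ₀]`), if at every torus exponent, on all small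
boxes `]0,γ]`, SOME coupling `g(γ) ∈ ]0,γ]` is reached at every `K` by an in-box run of some forward-generated construction `C₁`, then EVERY
forward-generated construction has `EndpointExistence` with `g⋆(γ) = g(γ)` — smaller targets only raise the backward orbit
(`backOrbit_mono`). [cite: Balaban1987RG1, Thm 2 p.259 (first sentence) and (0.20) p.256] -/
theorem endpointExistence_coop_of_oneTarget {γ₀ : ℝ} (hγ₀ : 0 < γ₀) (hHc : ContinuousOn H (Set.Ioc 0 γ₀))
    (hHm : MonotoneOn H (Set.Ioc 0 γ₀))
    {β : HBeta} (hβ : ∀ (k : ℕ) (p : Fin (k + 1) → ℝ), 0 < p (Fin.last k) → β k p = b k + H (p (Fin.last k)))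
    {C₁ : B12.Construction} (hgen₁ : ForwardGenerated C₁ β)
    (h : ∀ m : ℕ, ∃ γ₂ : ℝ, 0 < γ₂ ∧ ∀ γ : ℝ, 0 < γ → γ ≤ γ₂ → ∃ g : ℝ, 0 < g ∧ g ≤ γ ∧
      ∀ K : ℕ, ∃ g0 : ℝ, (C₁ ⟨K, m, g0⟩).flow.InInterval γ K ∧ (C₁ ⟨K, m, g0⟩).flow.g K = g)
    {C : B12.Construction} (hgen : ForwardGenerated C β) : EndpointExistence C := by
  intro m
  obtain ⟨γ₂, hγ₂, hγ⟩ := h m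
  refine ⟨min γ₂ γ₀, lt_min hγ₂ hγ₀, fun γ hγ0 hγle => ?_⟩
  obtain ⟨g, hg, -, hK⟩ := hγ γ hγ0 (hγle.trans (min_le_left _ _))
  refine ⟨g, hg, fun g' hg' hg'le K => ?_⟩
  obtain ⟨g0', hI', hK'⟩ := hK K
  have hγγ₀ : γ ≤ γ₀ := hγle.trans (min_le_right _ _)
  have hsub : Set.Ioc 0 γ ⊆ Set.Ioc 0 γ₀ := fun x hx => ⟨hx.1, hx.2.trans hγγ₀⟩
  obtain ⟨g0, hI0, hK0, -⟩ := run_coop_of_traj hγ0 (hHc.mono hsub) (hHm.mono hsub) hI'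
    (steps_dominated_of_coopRun hβ hgen₁ ⟨K, m, g0'⟩ hI') hβ hgen hg' (hg'le.trans_eq hK'.symm) m
  exact ⟨g0, hI0, hK0⟩

/-! ## §5 The linear road is decided by the linear cooperator -/

section Linear

variable {b : ℕ → ℝ} {C γ₀ : ℝ}

/-- The linear help `x ↦ C·x` is continuous on every box. [folklore] -/
theorem continuousOn_linHelp (C γ : ℝ) : ContinuousOn (fun x : ℝ => C * x) (Set.Ioc 0 γ) :=
  (continuous_const.mul continuous_id).continuousOn

/-- … and non-decreasing for `C ≥ 0`. [folklore] -/
theorem monotoneOn_linHelp (hC : 0 ≤ C) (γ : ℝ) : MonotoneOn (fun x : ℝ => C * x) (Set.Ioc 0 γ) :=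
  fun _ _ _ _ h => mul_le_mul_of_nonneg_left h hC

/-- **POSSIBLE ON THE LINEAR ROAD ⟹ EVERY FORWARD-GENERATED CONSTRUCTION OF THE LINEAR COOPERATOR `b_k + C g_k` HAS E** (`0 ≤ C`, `0 < γ₀`):
the realization witnessing possibility has `β¹ ≤ |β¹| ≤ C g_k`, and the cooperator inherits its runs (`endpointExistence_coop_of_dominated`).
[cite: Balaban1987RG1, Thm 2 p.259 (first sentence) and (2.12)–(2.14) p.268] -/
theorem endpointExistence_linCoop_of_endPossibleLin (hC : 0 ≤ C) (hγ₀ : 0 < γ₀) (h : EndPossibleLin b C γ₀)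
    {Cn : B12.Construction} (hgen : ForwardGenerated Cn (betaLin b C)) : EndpointExistence Cn := by
  obtain ⟨β', S', C', hb, hAF, -, hgen', hE'⟩ := h
  exact endpointExistence_coop_of_dominated (H := fun x => C * x) hγ₀ (continuousOn_linHelp C γ₀) (monotoneOn_linHelp hC γ₀) S' hb
    (fun k p hp => (le_abs_self _).trans (hAF k p hp)) hgen' hE' (fun k _ hp => betaLin_of_pos b C k hp) hgen

/-- **THE LINEAR ROAD IS DECIDED BY ONE MARKOV FAMILY** · `EndPossibleLin b C γ₀ ⟺ EndpointExistence (modelOf (betaLin b C))` (`0 ≤ C`, `0 < γ₀`):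
possibility over the whole (AF-1) class is the END of the canonical construction of the linear cooperator — ONE deterministic backward-orbit
condition per `(K, target)` (`EndDrawdownCooperatorExtremal.run_of_backOrbit` ∕ `backOrbit_ge_traj`). [cite: Balaban1987RG1, Thm 2 p.259 (first sentence) and (2.12)–(2.14) p.268] -/
theorem endPossibleLin_iff_modelOf (hC : 0 ≤ C) (hγ₀ : 0 < γ₀) :
    EndPossibleLin b C γ₀ ↔ EndpointExistence (modelOf (betaLin b C)) :=
  ⟨fun h => endpointExistence_linCoop_of_endPossibleLin hC hγ₀ h (modelOf_forwardGenerated _), fun hE =>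
    ⟨betaLin b C, splitLin b C, modelOf (betaLin b C), fun _ => rfl,
      fun k p hp => by have h := af1_splitLin b C γ₀ k p hp; rwa [abs_of_nonneg hC] at h,
      betaContH_betaLin b C γ₀, modelOf_forwardGenerated _, hE⟩⟩

/-- … equivalently: possible over the class iff the linear cooperator is FORCED within its own forward-generated constructions.
[cite: Balaban1987RG1, Thm 2 p.259 (first sentence) and (2.12)–(2.14) p.268] -/
theorem endPossibleLin_iff_allFwd (hC : 0 ≤ C) (hγ₀ : 0 < γ₀) :
    EndPossibleLin b C γ₀ ↔ ∀ Cn : B12.Construction, ForwardGenerated Cn (betaLin b C) → EndpointExistence Cn :=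
  ⟨fun h _ hgen => endpointExistence_linCoop_of_endPossibleLin hC hγ₀ h hgen,
    fun h => (endPossibleLin_iff_modelOf hC hγ₀).mpr (h _ (modelOf_forwardGenerated _))⟩

/-- **BOX-FREE** · possibility on the linear road does not depend on the box on which (AF-1) and (C) are asked (`0 ≤ C`). [folklore] -/
theorem endPossibleLin_box_free (hC : 0 ≤ C) {γ₀ γ₀' : ℝ} (hγ₀ : 0 < γ₀) (hγ₀' : 0 < γ₀') :
    EndPossibleLin b C γ₀ ↔ EndPossibleLin b C γ₀' := by
  rw [endPossibleLin_iff_modelOf hC hγ₀, endPossibleLin_iff_modelOf hC hγ₀']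

/-- **THE ONE-SIDED CLASS IS THE TWO-SIDED CLASS** · if SOME history family with one-loop part `b` and remainder merely bounded ABOVE,
`β¹_{k+1}(g_0,…,g_k) ≤ C g_k` on the `]0,γ₀]`-histories — no lower bound, no continuity —, has a forward-generated construction with E, then
`EndPossibleLin b C γ₀` (`0 ≤ C`, `0 < γ₀`). [cite: Balaban1987RG1, Thm 2 p.259 (first sentence) and (2.12)–(2.14) p.268] -/
theorem endPossibleLin_of_upperRealization (hC : 0 ≤ C) (hγ₀ : 0 < γ₀) {β' : HBeta} (S' : B12Beta.OneLoopSplit β')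
    (hb : ∀ j, S'.β0 j = b j) (hup : ∀ (k : ℕ) (p : Fin (k + 1) → ℝ), p ∈ B12Beta.HistBox γ₀ k → S'.β1 k p ≤ C * p (Fin.last k))
    {C' : B12.Construction} (hgen' : ForwardGenerated C' β') (hE' : EndpointExistence C') : EndPossibleLin b C γ₀ :=
  (endPossibleLin_iff_modelOf hC hγ₀).mpr
    (endpointExistence_coop_of_dominated (H := fun x => C * x) hγ₀ (continuousOn_linHelp C γ₀) (monotoneOn_linHelp hC γ₀) S' hb
      hup hgen' hE' (fun k _ hp => betaLin_of_pos b C k hp) (modelOf_forwardGenerated _))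

/-- Monotone in the constant: `EndPossibleLin b C γ₀ ⟹ EndPossibleLin b C′ γ₀` for `C ≤ C′`. [folklore] -/
theorem endPossibleLin_mono {C' : ℝ} (hCC' : C ≤ C') (h : EndPossibleLin b C γ₀) : EndPossibleLin b C' γ₀ := by
  obtain ⟨β', S', Cn, hb, hAF, hcont, hgen, hE⟩ := h
  exact ⟨β', S', Cn, hb, fun k p hp => (hAF k p hp).trans (mul_le_mul_of_nonneg_right hCC' (hp (Fin.last k)).1.le), hcont, hgen, hE⟩

end Linear

end

end Summit.QuantumFields.BalabanUV.Gaps.EndDrawdownCooperatorExtremal
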